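import Mathlib
import Literature.NumberTheory.Sieve.Maynard2016SystemUnique
import HarnessLib

/-!
# Maynard 2016: the λ-moduli are automatically pairwise coprime (W-trick)

Topic `Literature/NumberTheory/Sieve`. J. Maynard, *Large gaps between primes*, Ann. of Math. (2)
183 (2016), 915–933 = arXiv:1408.5110, §6, proof of Lemma 6 (p. 9): "there is no contribution
unless all of `d₁d₁', …, d_k d_k'` are pairwise coprime, and all of `e₁e₁', …, e_k e_k'` are pairwise
coprime (since any `p ∣ (e_i e_i', e_j e_j')`, say, would have to divide `(h_i − h_j) q`, which is in
contradiction to `p ≤ x^{1/10} < q` being prime and `(e_i e_i', P_w) = 1`)". By the W-trick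
(`Maynard2016TupleArith.eventually_coprime_hTuple_sub`) a modulus coprime to `P_w` is coprime to
every `h_j − h_i`, which is the hypothesis `hcop` below.

PROVED here (no named facts): `eq_one_of_dvd_add_mul` (a common divisor `d < q` of `n + a q` and
`n + b q`, coprime to `|b − a|`, is `1`), `coprime_moduli_of_dvd_add_mul` (the `d`-moduli),
`eq_one_of_dvd_mul_add_mul_sub_one` and `coprime_moduli_of_dvd_mul_add_mul_sub_one` (the
`e`-moduli, using `(e, m) = 1` from `e ∣ m t − 1`).

## References

* J. Maynard, *Large gaps between primes*, Ann. of Math. (2) 183 (2016), 915–933; arXiv:1408.5110,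
  §6, proof of Lemma 6, p. 9 (before display (6.7)). [Maynard2016LargeGaps]
-/

open Filter Finset
open scoped Topology

namespace Literature.NumberTheory.Sieve

namespace Maynard2016

/-- A common divisor `d < q` (`q` prime) of `n + a q` and `n + b q` which is coprime to `|b − a|`
equals `1`. [cite: Maynard2016LargeGaps, §6 proof of Lemma 6 (p. 9, «would have to divide (h_i − h_j) q»)] -/
theorem eq_one_of_dvd_add_mul {d n a b q : ℕ} (hq : q.Prime) (hdq : d < q)
    (ha : d ∣ n + a * q) (hb : d ∣ n + b * q) (hcop : Nat.Coprime d (((b : ℤ) - a).natAbs)) :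
    d = 1 := by
  have h1 : (d : ℤ) ∣ (n : ℤ) + a * q := by exact_mod_cast ha
  have h2 : (d : ℤ) ∣ (n : ℤ) + b * q := by exact_mod_cast hb
  have h3 : (d : ℤ) ∣ ((b : ℤ) - a) * q := by
    have := dvd_sub h2 h1
    have e : ((n : ℤ) + b * q) - ((n : ℤ) + a * q) = ((b : ℤ) - a) * q := by ring
    rwa [e] at this
  have h4 : d ∣ ((b : ℤ) - a).natAbs * q := by
    have := Int.natCast_dvd_natCast.1 (Int.dvd_natAbs.2 h3)
    rwa [Int.natAbs_mul, Int.natAbs_natCast] at this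
  have h5 : d ∣ q := hcop.dvd_of_dvd_mul_left h4
  rcases (Nat.dvd_prime hq).1 h5 with h | h
  · exact h
  · omega

/-- **The `d`-moduli are pairwise coprime.** If `A ∣ n + a q`, `A' ∣ n + b q`, `0 < A < q` (`q`
prime) and `(A, |b − a|) = 1`, then `(A, A') = 1`. [cite: Maynard2016LargeGaps, §6 proof of Lemma 6 (p. 9)] -/
theorem coprime_moduli_of_dvd_add_mul {A A' n a b q : ℕ} (hq : q.Prime) (hA : 0 < A) (hAq : A < q)
    (ha : A ∣ n + a * q) (hb : A' ∣ n + b * q) (hcop : Nat.Coprime A (((b : ℤ) - a).natAbs)) :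
    Nat.Coprime A A' := by
  have hg1 : A.gcd A' ∣ n + a * q := dvd_trans (Nat.gcd_dvd_left A A') ha
  have hg2 : A.gcd A' ∣ n + b * q := dvd_trans (Nat.gcd_dvd_right A A') hb
  have hgq : A.gcd A' < q := lt_of_le_of_lt (Nat.le_of_dvd hA (Nat.gcd_dvd_left A A')) hAq
  have hgcop : Nat.Coprime (A.gcd A') (((b : ℤ) - a).natAbs) :=
    Nat.Coprime.coprime_dvd_left (Nat.gcd_dvd_left A A') hcop
  exact eq_one_of_dvd_add_mul hq hgq hg1 hg2 hgcop

/-- A common divisor `d < q` (`q` prime) of `m(n + a q) − 1` and `m(n + b q) − 1` (both `≥ 0` as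
integers, i.e. `m(n + a q), m(n + b q) ≥ 1`) which is coprime to `|b − a|` equals `1`. [cite: Maynard2016LargeGaps, §6 proof of Lemma 6 (p. 9, «any p ∣ (e_i e_i', e_j e_j') would have to divide (h_i − h_j) q»)] -/
theorem eq_one_of_dvd_mul_add_mul_sub_one {d n a b q m : ℕ} (hq : q.Prime) (hdq : d < q)
    (hpa : 1 ≤ m * (n + a * q)) (hpb : 1 ≤ m * (n + b * q))
    (ha : d ∣ m * (n + a * q) - 1) (hb : d ∣ m * (n + b * q) - 1)
    (hcop : Nat.Coprime d (((b : ℤ) - a).natAbs)) : d = 1 := by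
  have hmd : Nat.Coprime m d := coprime_of_dvd_mul_sub_one' ha hpa
  have h1 : (d : ℤ) ∣ (m : ℤ) * (n + a * q) - 1 := by
    have := Int.natCast_dvd_natCast.2 ha
    rwa [Nat.cast_sub hpa] at this
  have h2 : (d : ℤ) ∣ (m : ℤ) * (n + b * q) - 1 := by
    have := Int.natCast_dvd_natCast.2 hb
    rwa [Nat.cast_sub hpb] at this
  have h3 : (d : ℤ) ∣ (((b : ℤ) - a) * q) * m := by
    have := dvd_sub h2 h1
    have e : ((m : ℤ) * (n + b * q) - 1) - ((m : ℤ) * (n + a * q) - 1) =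
        (((b : ℤ) - a) * q) * m := by ring
    rwa [e] at this
  have h4 : d ∣ (((b : ℤ) - a).natAbs * q) * m := by
    have := Int.natCast_dvd_natCast.1 (Int.dvd_natAbs.2 h3)
    rwa [Int.natAbs_mul, Int.natAbs_mul, Int.natAbs_natCast, Int.natAbs_natCast] at this
  have h5 : d ∣ ((b : ℤ) - a).natAbs * q := hmd.symm.dvd_of_dvd_mul_right h4
  have h6 : d ∣ q := hcop.dvd_of_dvd_mul_left h5
  rcases (Nat.dvd_prime hq).1 h6 with h | h
  · exact h
  · omega

/-- **The `e`-moduli are pairwise coprime.** If `B ∣ m(n + a q) − 1`, `B' ∣ m(n + b q) − 1`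
(`m(n + a q), m(n + b q) ≥ 1`), `0 < B < q` (`q` prime) and `(B, |b − a|) = 1`, then `(B, B') = 1`.
[cite: Maynard2016LargeGaps, §6 proof of Lemma 6 (p. 9)] -/
theorem coprime_moduli_of_dvd_mul_add_mul_sub_one {B B' n a b q m : ℕ} (hq : q.Prime)
    (hB : 0 < B) (hBq : B < q) (hpa : 1 ≤ m * (n + a * q)) (hpb : 1 ≤ m * (n + b * q))
    (ha : B ∣ m * (n + a * q) - 1) (hb : B' ∣ m * (n + b * q) - 1)
    (hcop : Nat.Coprime B (((b : ℤ) - a).natAbs)) : Nat.Coprime B B' := by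
  have hg1 : B.gcd B' ∣ m * (n + a * q) - 1 := dvd_trans (Nat.gcd_dvd_left B B') ha
  have hg2 : B.gcd B' ∣ m * (n + b * q) - 1 := dvd_trans (Nat.gcd_dvd_right B B') hb
  have hgq : B.gcd B' < q := lt_of_le_of_lt (Nat.le_of_dvd hB (Nat.gcd_dvd_left B B')) hBq
  have hgcop : Nat.Coprime (B.gcd B') (((b : ℤ) - a).natAbs) :=
    Nat.Coprime.coprime_dvd_left (Nat.gcd_dvd_left B B') hcop
  exact eq_one_of_dvd_mul_add_mul_sub_one hq hgq hpa hpb hg1 hg2 hgcop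

end Maynard2016

end Literature.NumberTheory.Sieve
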